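import Literature.NumberTheory.EllipticCurves.ModularCurve
import Literature.NumberTheory.EllipticCurves.QuadraticTwist
import Literature.NumberTheory.EllipticCurves.Isogeny
import Literature.NumberTheory.EllipticCurves.GlobalMinimalModel
import Literature.NumberTheory.DiophantineGeometry.Conductor
import HarnessLib
import HarnessLib.Audit.Tags

/-!
# Candidate E-imc-5: the WITHIN-CLASS orientation law at an additive prime `p ≥ 5` — the optimal curve
# is never the starred end of a rational `p`-isogeny facing an unstarred end (`OptimalUnstarredAcrossIsogeny p`)
# — cell `bsd-f2-manin` (D-0131 (3) frontier: the Manin constant at additive primes). `@[conjecture]`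
# leaf (NOTHING asserted; definitions only; proved edges in `RamifiedTwistEdges.lean`).

HONEST FRAMING. LENS = Iwasawa-main-conjecture / Λ-adic integrality read as RAMIFIED-QUADRATIC-TWIST
laws at the additive prime (planner-of-record `bsd-f2-manin-imc`, HOME
`run/shared/lean/pub/bsd-f2-manin/MEMO-imc.md` §§1–5 (sha16 7c7fd3ff00b6a3f6), Props VERBATIM from
HOME/imc/Sketch-imc.lean (namespace `BsdF2ManinImc`, farm rc 0) with its two abbreviations inlined:
`pStar p = (((-1)^(p/2) · p : ℤ) : ℚ)` (`p* = (−1)^{(p−1)/2} p` for odd `p`, the spelling of the tree's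
`ModularParametrizationData.deg_mul_sq_mul_sq_eq_of_quadraticTwist_pStar`) and `IsLatticeOptimal D`
= the lattice clause `Λ_W = c·Λ_f`. «Ramified twist pair at `p`»: `W`, `W′` globally minimal models
of the `X₀(N)`-optimal curves of a class `𝒜` and of `𝒜 ⊗ χ_{p*}` (data `D`, `D′` at the CONDUCTOR
levels with the lattice clauses — refuter-1 traps T1/T2/T3 on BOTH curves), both additive at `p`
(`p² ∣ N`), SAME conductor (automatic for `p ≥ 5` potentially good; a restriction at `p = 3`),
`W′ ~ W ⊗ χ_{p*}`. Lens dictionary and why this is the IMC reading: memo §1 (no Hida family through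
an `a_p = 0` newform; the family is the twist orbit, `R_ψ` plays `U_p`, the «divisibility» is
Edixhoven's index law `[s⁻¹Λ_f : Λ_{f⊗ψ}] ∈ {1, p}`). NOT in print (memo §7; refuter-2 pre-placement
B4/B5): printed twist transports of the Manin `p`-part need the partner SEMISTABLE at `p` (Stevens
1989 §5; tree `ManinConstantQuadraticTwist*`) or settle only the potentially supersingular case
(Edixhoven 1991 §4); Watkins 2002 §2.1 / Delaunay 2003 give the degree identity «if we assume the
Manin constants are the same» (tree PROVED `…deg_mul_sq_mul_sq_eq_of_quadraticTwist_pStar`: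
`D′.deg·D.c²·u² = p·D.deg·D′.c²`, silent on optimality and on `ord_p c`). Data: memo §5 and the
in-seat PAIRWISE TWIST CENSUS v0 (HOME/imc/TWISTCENSUS-v0-N1e5-*, N < 10⁵, 578 278 rows) which
KILLED the v1 forms of IMC-D / IMC-A without `E[p]` irreducible (HOME/CANDIDATES.md §F F-imc-1/3:
50a1 ⊗ χ₅ ≅ 50b3, 5-isogenous to the optimal 50b1). Refuter verdicts: REF1 **SURVIVES** 2026-08-27T14:02Z
(HOME/REFUTER-ref1.md §R1.7: independent census 0 violations at p ≥ 5, non-vacuous only at p ∈ {5, 7}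
in range (116 + 60 cases); the bound 5 ≤ p is load-bearing (27a, 54a); BC7 CLEAN); REF2 pending at
filing.

THIS ROW (E-imc-5, memo §3 IMC-O, §5(f)(g); explains every index-`p` «flip» row of the twist census:
twisting by `χ_{p*}` swaps `T ↔ T*`, so optimality FLIPS across the isogeny): at an additive prime
`p ≥ 5`, if the optimal curve `W` (lattice-optimal datum at the conductor level) admits a rational
isogeny `φ : W → W₂` of degree `p` to a globally minimal `W₂` with `v_p(Δ_min(W₂)) < 6` (unstarred
Kodaira type), then `v_p(Δ_min(W)) < 6` as well. BC5 WITNESS: ecdata census (isostar.py, N < 10⁵):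
II–II* 255, IV–IV* 255 at `p = 5`, III–III* 62 at `p = 7`, 78 more at `p ≥ 11`; 0 exceptions in 650;
vacuous for type-preserving and potentially multiplicative `p`-isogenies; FALSE as stated at `p = 3`
(54a1 –3– 54a3), whence `5 ≤ p`.
-/

noncomputable section

open scoped MatrixGroups ModularForm

open CongruenceSubgroup WeierstrassCurve
  Literature.NumberTheory.EllipticCurves Literature.NumberTheory.EllipticCurves.ModularForms

namespace Summit.BirchSwinnertonDyer.Rank1Residual.ManinAdditive

/-- **Candidate E-imc-5 `OptimalUnstarredAcrossIsogeny p` (cell bsd-f2-manin; a LAW, NOT in print,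
nothing asserted):** for a prime `p ≥ 5`, a globally minimal `W` with `p² ∣ N(W)` and a lattice-optimal
datum `D` at the conductor level (`W` optimal), a globally minimal `W₂` and an isogeny `φ : W → W₂`
of degree `p` (tree `WeierstrassCurve.Isogeny.degree`): `v_p(Δ_min(W₂)) < 6 → v_p(Δ_min(W)) < 6`.
[cite: EdixhovenManin1991, §4 (shape only: starred/unstarred Kodaira types II↔IV*, III↔III*, IV↔II* under twisting; the optimality-orientation law is NOT in print — cell bsd-f2-manin MEMO-imc.md §3 IMC-O)] -/
@[conjecture] def OptimalUnstarredAcrossIsogeny (p : ℕ) : Prop :=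
  ∀ (W W₂ : WeierstrassCurve ℚ) [W.IsElliptic] [W.IsGloballyMinimal] [W₂.IsElliptic]
    [W₂.IsGloballyMinimal] [NeZero (W.conductorNorm ℤ)]
    (D : ModularParametrizationData W (W.conductorNorm ℤ)) (φ : WeierstrassCurve.Isogeny W W₂),
    p.Prime → 5 ≤ p →
    (∀ z ∈ D.L.lattice, ∃ w ∈ periodLattice D.f, z = D.c * w) →
    p ^ 2 ∣ W.conductorNorm ℤ → φ.degree = p →
    padicValInt p W₂.minimalDiscriminantInt < 6 → padicValInt p W.minimalDiscriminantInt < 6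

end Summit.BirchSwinnertonDyer.Rank1Residual.ManinAdditive

end
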